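import Summits.CriticalPhenomena.CardyFormulaZ2.Theorems.CardySelfDualSegmentSegmentClosedStubBoxCrossRatio
import Summits.CriticalPhenomena.CardyFormulaZ2.Theorems.CardyIKTransportIKLinearTransportStubCouplingToLimitsGeometry
import Summits.CriticalPhenomena.CardyFormulaZ2.Theorems.RectilinearCardy.Negative.RectilinearCardyReductions
import Literature.Probability.RandomPlanarGeometry.RectangleModulusProofs
import Literature.Probability.RandomPlanarGeometry.CrossRatioContinuity

/-!
# Stub `stub_rectangleFamily` (line `registered`, crux `SimilarityUpgrade`, stmt-CriticalPhenomena-4597)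

Crux `Summit.CriticalPhenomena.CardyFormulaZ2.Theses.CardyWhiteToColoured.SimilarityUpgrade`,
line `registered` (skeleton `Cruxes/SimilarityUpgrade/Lines/birth.lean`), stub **R**
`stub_rectangleFamily`: the two families of corner-marked axis-parallel rectangles
`(0,w) × (0,1)` (`w > 0`) and their conformal moduli.

* `Q' w := rectQuad 0 w 0 1` (tree, `QuadCrossingSquareModel.lean`): the box with its corners
  marked counterclockwise from the bottom-left one, `(P₀, P₁, P₂, P₃) = (0, w, w + i, i)`; arc `0`
  is the bottom side and arc `2` the top side (`mem_rectQuad_arc_zero/two`).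
* `Q w` := the cyclic re-marking by three of `Q' w` (`RectangleFamily.exists_shift3`: same carrier,
  boundary loop re-based at the fourth mark `u ↦ γ (u + m₃)`, marks
  `(0, m₀ + 1 - m₃, m₁ + 1 - m₃, m₂ + 1 - m₃)`), so that `Q w` has arcs `0, 2` = the left and
  right sides of the box and marked points `(i, 0, w, w + i)` — the marking `D₄` of
  Bollobás–Riordan, *Percolation* (2006), Ch. 7 §7.1, of the tree fact
  `rectangle_crossRatio_eq_elliptic`.

Conclusions: carriers/arcs (tree lemmas on `rectQuad`); rectilinearity
(`RectilinearCardy.Negative.isRectilinear_of_carrier_eq`); the flip `η(Q' w) = 1 - η(Q w)`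
(`BoxCrossRatio.exists_isUniformizing_of_pt_eq_add_three` + conformal invariance of the
cross-ratio); every `η ∈ (0,1)` is the modulus of some `Q w`
(`rectangle_crossRatio_eq_elliptic_holds`, `k = (1 - √η)/(1 + √η)`, `w = 2K(k²)/K(1-k²)`);
continuity of `w ↦ η(Q w)` (uniformly convergent boundary loops,
`CouplingToLimits.tendstoUniformly_boundary_perturbQuad`, and Radó,
`ConformalRectangle.tendsto_crossRatio_of_tendstoUniformly`).

References: B. Bollobás, O. Riordan, *Percolation* (2006), Ch. 7 §7.1 pp. 183–185;
Ch. Pommerenke, *Boundary Behaviour of Conformal Maps* (1992), §2.3 Thm. 2.11 (Radó);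
L. V. Ahlfors, *Complex Analysis* (1979), Ch. 3 §3.1 and Ch. 6 §2.3.
-/

noncomputable section

namespace Summit.CriticalPhenomena.CardyFormulaZ2.Cruxes.SimilarityUpgrade.Stubs

open Filter Topology Set
open Literature.Probability.RandomPlanarGeometry
open Literature.Probability.Percolation (rectQuad rectQuad_carrier mem_rectQuad_arc_zero
  mem_rectQuad_arc_one mem_rectQuad_arc_two mem_rectQuad_arc_three quarterMarks)
open UpperHalfPlane (upperHalfPlaneSet)
open Summit.CriticalPhenomena.CardyFormulaZ2.Cruxes.SegmentClosed.Sketch.BoxCrossRatio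
  (rectQuad_pt exists_isUniformizing_of_pt_eq_add_three)
open Summit.CriticalPhenomena.CardyFormulaZ2.Theorems.IKLinearTransport.PinnedDiagramExchange.CouplingToLimits
  (tendstoUniformly_boundary_perturbQuad)
open Summit.CriticalPhenomena.CardyFormulaZ2.Theorems.RectilinearCardy.Negative
  (isRectilinear_of_carrier_eq)

namespace RectangleFamily

/-! ### Re-marking a conformal rectangle by three -/

/-- **Re-marking by three.** Every conformal rectangle `R = (Ω; P₀, P₁, P₂, P₃)` (marks
`m₀ < m₁ < m₂ < m₃ < m₀ + 1`) has a cyclically re-marked copy `R' = (Ω; P₃, P₀, P₁, P₂)`: the same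
carrier, the boundary loop re-based at the fourth mark `u ↦ R.boundary (u + m₃)` and the marks
`(0, m₀ + 1 - m₃, m₁ + 1 - m₃, m₂ + 1 - m₃)`; its arcs `0, 2` are the arcs `3, 1` of `R` and its
marked points are `P₃, P₀, P₁, P₂` (the three-step analogue of the tree's
`MarkedDomain.exists_shiftMarks`). [folklore] -/
theorem exists_shift3 (R : ConformalRectangle) : ∃ R' : ConformalRectangle,
    R'.carrier = R.carrier ∧ (∀ u, R'.boundary u = R.boundary (u + R.mark 3)) ∧
    R'.arc 0 = R.arc 3 ∧ R'.arc 2 = R.arc 1 ∧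
    R'.pt 0 = R.pt 3 ∧ R'.pt 1 = R.pt 0 ∧ R'.pt 2 = R.pt 1 ∧ R'.pt 3 = R.pt 2 := by
  -- adapted from `MarkedDomain.exists_shiftMarks` (ConformalRectangleShift.lean)
  obtain ⟨h0, h1, h2, h3, h4⟩ := R.marks_chain
  obtain ⟨-, n1, -, n3⟩ := R.nextMarks_eq
  have him : ∀ a b : ℝ, (fun u => R.boundary (u + R.mark 3)) '' Icc a b =
      R.boundary '' Icc (a + R.mark 3) (b + R.mark 3) := fun a b => by
    rw [show (fun u => R.boundary (u + R.mark 3)) = R.boundary ∘ fun u => u + R.mark 3 from rfl,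
      image_comp, image_add_const_Icc]
  let R' : ConformalRectangle :=
    { carrier := R.carrier
      boundary := fun u => R.boundary (u + R.mark 3)
      isOpen := R.isOpen
      isBounded := R.isBounded
      isConnected := R.isConnected
      continuous_boundary := R.continuous_boundary.comp (continuous_id.add continuous_const)
      periodic_boundary := R.periodic_boundary.add_const _
      injOn_boundary := fun s hs t ht hst => add_right_cancel
        (R.toJordanDomain.injOn_boundary_Ico (R.mark 3)
          (show s + R.mark 3 ∈ Ico (R.mark 3) (R.mark 3 + 1) from
            ⟨by linarith [hs.1], by linarith [hs.2]⟩)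
          (show t + R.mark 3 ∈ Ico (R.mark 3) (R.mark 3 + 1) from
            ⟨by linarith [ht.1], by linarith [ht.2]⟩) hst)
      range_boundary := by
        rw [show (fun u => R.boundary (u + R.mark 3)) = R.boundary ∘ fun u => u + R.mark 3 from rfl,
          (add_right_surjective _).range_comp]
        exact R.range_boundary
      mark := ![0, R.mark 0 + 1 - R.mark 3, R.mark 1 + 1 - R.mark 3, R.mark 2 + 1 - R.mark 3]
      strictMono_mark := Fin.strictMono_iff_lt_succ.2 fun k => by
        fin_cases k
        · show (0 : ℝ) < R.mark 0 + 1 - R.mark 3; linarith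
        · show R.mark 0 + 1 - R.mark 3 < R.mark 1 + 1 - R.mark 3; linarith
        · show R.mark 1 + 1 - R.mark 3 < R.mark 2 + 1 - R.mark 3; linarith
      mark_mem := fun k => by
        fin_cases k
        · show (0 : ℝ) ∈ Ico 0 1; exact ⟨le_rfl, one_pos⟩
        · show R.mark 0 + 1 - R.mark 3 ∈ Ico 0 1; exact ⟨by linarith, by linarith⟩
        · show R.mark 1 + 1 - R.mark 3 ∈ Ico 0 1; exact ⟨by linarith, by linarith⟩
        · show R.mark 2 + 1 - R.mark 3 ∈ Ico 0 1; exact ⟨by linarith, by linarith⟩ }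
  obtain ⟨n0', -, n2', -⟩ := R'.nextMarks_eq
  have hp : R.boundary = R.boundary ∘ fun u => u + 1 := funext fun u => (R.periodic_boundary u).symm
  refine ⟨R', rfl, fun u => rfl, ?_, ?_, ?_, ?_, ?_, ?_⟩
  · show R'.boundary '' Icc (R'.mark 0) (R'.nextMark 0) = R.boundary '' Icc (R.mark 3) (R.nextMark 3)
    rw [n0', n3]
    show (fun u => R.boundary (u + R.mark 3)) '' Icc 0 (R.mark 0 + 1 - R.mark 3) = _
    rw [him]
    congr 2 <;> ring
  · show R'.boundary '' Icc (R'.mark 2) (R'.nextMark 2) = R.boundary '' Icc (R.mark 1) (R.nextMark 1)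
    rw [n2', n1]
    show (fun u => R.boundary (u + R.mark 3)) ''
      Icc (R.mark 1 + 1 - R.mark 3) (R.mark 2 + 1 - R.mark 3) = _
    rw [him]
    conv_rhs => rw [hp, image_comp, image_add_const_Icc]
    congr 2 <;> ring
  · show R.boundary (0 + R.mark 3) = R.boundary (R.mark 3)
    rw [zero_add]
  · show R.boundary (R.mark 0 + 1 - R.mark 3 + R.mark 3) = R.boundary (R.mark 0)
    rw [sub_add_cancel]
    exact R.periodic_boundary _
  · show R.boundary (R.mark 1 + 1 - R.mark 3 + R.mark 3) = R.boundary (R.mark 1)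
    rw [sub_add_cancel]
    exact R.periodic_boundary _
  · show R.boundary (R.mark 2 + 1 - R.mark 3 + R.mark 3) = R.boundary (R.mark 2)
    rw [sub_add_cancel]
    exact R.periodic_boundary _

/-! ### Uniform convergence of the boundary loops of the model rectangles -/

/-- The boundary loops of the boxes `rectQuad 0 (w n) 0 1` converge uniformly to that of
`rectQuad 0 w₀ 0 1` when `w n → w₀` (the tree's `tendstoUniformly_boundary_perturbQuad` with the
identity chart). [folklore] -/
theorem tendstoUniformly_boundary_rectQuad {w : ℕ → ℝ} {w₀ : ℝ} (hw : ∀ n, 0 < w n)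
    (hw₀ : 0 < w₀) (hlim : Tendsto w atTop (𝓝 w₀)) :
    TendstoUniformly (fun n => (rectQuad 0 (w n) 0 1 (hw n) one_pos).boundary)
      (rectQuad 0 w₀ 0 1 hw₀ one_pos).boundary atTop :=
  tendstoUniformly_boundary_perturbQuad (Homeomorph.refl ℂ) (x₀ := fun _ => 0) (x₁ := w)
    (y₀ := fun _ => 0) (y₁ := fun _ => 1) hw (fun _ => one_pos) hw₀ one_pos tendsto_const_nhds
    hlim tendsto_const_nhds tendsto_const_nhds

/-! ### Continuity of the modulus along a family with uniformly continuous loops (Radó) -/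

/-- **Continuity of the modulus along a one-parameter family of conformal rectangles** whose
boundary loops converge uniformly and whose marked points converge along every sequence
`w n → w₀` (`w n, w₀ > 0`): for every `ε > 0` the cross-ratios of arbitrary uniformizing data of
`Q w` and `Q w₀` differ by less than `ε` once `|w - w₀|` is small. Radó's theorem in the form
`ConformalRectangle.tendsto_crossRatio_of_tendstoUniformly`, the independence of the cross-ratio
from the datum (`ConformalRectangle.crossRatio_eq_of_isUniformizing_holds`) and a sequential
argument by contradiction. [cite: PommerenkeBBCM1992, Thm. 2.11] -/
theorem modulus_continuous (Q : ℝ → ConformalRectangle)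
    (hJ : ∀ (w : ℕ → ℝ) (w₀ : ℝ), (∀ n, 0 < w n) → 0 < w₀ → Tendsto w atTop (𝓝 w₀) →
      TendstoUniformly (fun n => (Q (w n)).boundary) (Q w₀).boundary atTop)
    (hpt : ∀ (w : ℕ → ℝ) (w₀ : ℝ), (∀ n, 0 < w n) → 0 < w₀ → Tendsto w atTop (𝓝 w₀) →
      ∀ i, Tendsto (fun n => (Q (w n)).pt i) atTop (𝓝 ((Q w₀).pt i))) :
    ∀ w₀ : ℝ, 0 < w₀ → ∀ ε : ℝ, 0 < ε → ∃ ρ : ℝ, 0 < ρ ∧ ∀ w : ℝ, 0 < w → |w - w₀| < ρ →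
      ∀ (φ : ConformalEquiv upperHalfPlaneSet (Q w).carrier) (x : Fin 4 → ℝ)
        (φ₀ : ConformalEquiv upperHalfPlaneSet (Q w₀).carrier) (x₀ : Fin 4 → ℝ),
        (Q w).IsUniformizing φ x → (Q w₀).IsUniformizing φ₀ x₀ →
          |crossRatio x - crossRatio x₀| < ε := by
  intro w₀ hw₀ ε hε
  -- one uniformizing datum per parameter: the modulus function `w ↦ crossRatio (y w)`
  choose ψ y hψ using fun w => MarkedDomain.exists_isUniformizing_holds (Q w)
  suffices H : ∃ ρ : ℝ, 0 < ρ ∧ ∀ w : ℝ, 0 < w → |w - w₀| < ρ →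
      |crossRatio (y w) - crossRatio (y w₀)| < ε by
    obtain ⟨ρ, hρ, hρ'⟩ := H
    refine ⟨ρ, hρ, fun w hw hww φ x φ₀ x₀ hφ hφ₀ => ?_⟩
    rw [ConformalRectangle.crossRatio_eq_of_isUniformizing_holds hφ (hψ w),
      ConformalRectangle.crossRatio_eq_of_isUniformizing_holds hφ₀ (hψ w₀)]
    exact hρ' w hw hww
  by_contra hcon
  push Not at hcon
  choose w hwpos hwclose hwfar using fun n : ℕ => hcon (1 / ((n : ℝ) + 1)) Nat.one_div_pos_of_nat
  have hlim : Tendsto w atTop (𝓝 w₀) := by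
    rw [Metric.tendsto_atTop]
    intro e he
    obtain ⟨N, hN⟩ := exists_nat_one_div_lt he
    refine ⟨N, fun n hn => ?_⟩
    rw [Real.dist_eq]
    exact (hwclose n).trans_le ((Nat.one_div_le_one_div hn).trans hN.le)
  have hT := ConformalRectangle.tendsto_crossRatio_of_tendstoUniformly (Q := fun n => Q (w n))
    (R := Q w₀) (hJ w w₀ hwpos hw₀ hlim) (hpt w w₀ hwpos hw₀ hlim) (fun n => ψ (w n))
    (fun n => y (w n)) (fun n => hψ (w n)) (ψ w₀) (y w₀) (hψ w₀)
  obtain ⟨n, hn⟩ := ((Metric.tendsto_nhds.1 hT) ε hε).exists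
  rw [Real.dist_eq] at hn
  exact (not_lt.2 (hwfar n)) hn

/-! ### The two families -/

section Families

variable (sh : ConformalRectangle → ConformalRectangle)
  (hsh : ∀ R : ConformalRectangle, (sh R).carrier = R.carrier ∧
    (∀ u, (sh R).boundary u = R.boundary (u + R.mark 3)) ∧
    (sh R).arc 0 = R.arc 3 ∧ (sh R).arc 2 = R.arc 1 ∧
    (sh R).pt 0 = R.pt 3 ∧ (sh R).pt 1 = R.pt 0 ∧ (sh R).pt 2 = R.pt 1 ∧ (sh R).pt 3 = R.pt 2)
  (Q' : ℝ → ConformalRectangle)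
  (hQ' : ∀ (w : ℝ) (hw : 0 < w), Q' w = rectQuad 0 w 0 1 hw one_pos)

include hQ' in
/-- Carrier and arcs `0, 2` of the bottom-to-top family `Q' w = rectQuad 0 w 0 1`. [folklore] -/
theorem bt_family (w : ℝ) (hw : 0 < w) :
    (Q' w).carrier = (Ioo (0 : ℝ) w ×ℂ Ioo (0 : ℝ) 1) ∧
      (Q' w).arc 0 = {z : ℂ | z.im = 0 ∧ z.re ∈ Icc (0 : ℝ) w} ∧
      (Q' w).arc 2 = {z : ℂ | z.im = 1 ∧ z.re ∈ Icc (0 : ℝ) w} := by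
  rw [hQ' w hw]
  refine ⟨rectQuad_carrier hw one_pos, ?_, ?_⟩
  · ext z; exact mem_rectQuad_arc_zero hw one_pos
  · ext z; exact mem_rectQuad_arc_two hw one_pos

include hsh hQ' in
/-- Carrier and arcs `0, 2` of the left-to-right family `Q w = sh (Q' w)`. [folklore] -/
theorem lr_family (w : ℝ) (hw : 0 < w) :
    (sh (Q' w)).carrier = (Ioo (0 : ℝ) w ×ℂ Ioo (0 : ℝ) 1) ∧
      (sh (Q' w)).arc 0 = {z : ℂ | z.re = 0 ∧ z.im ∈ Icc (0 : ℝ) 1} ∧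
      (sh (Q' w)).arc 2 = {z : ℂ | z.re = w ∧ z.im ∈ Icc (0 : ℝ) 1} := by
  obtain ⟨hc, -, ha0, ha2, -⟩ := hsh (Q' w)
  rw [hc, ha0, ha2, hQ' w hw]
  refine ⟨rectQuad_carrier hw one_pos, ?_, ?_⟩
  · ext z; exact mem_rectQuad_arc_three hw one_pos
  · ext z; exact mem_rectQuad_arc_one hw one_pos

include hsh hQ' in
/-- The marked points of `Q w = sh (Q' w)` are the corners `i, 0, w, w + i`. [folklore] -/
theorem lr_pt (w : ℝ) (hw : 0 < w) :
    (sh (Q' w)).pt 0 = Complex.I ∧ (sh (Q' w)).pt 1 = 0 ∧ (sh (Q' w)).pt 2 = (w : ℂ) ∧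
      (sh (Q' w)).pt 3 = (w : ℂ) + Complex.I := by
  obtain ⟨-, -, -, -, h0, h1, h2, h3⟩ := hsh (Q' w)
  obtain ⟨p0, p1, p2, p3⟩ := rectQuad_pt hw (one_pos : (0 : ℝ) < 1) (x₀ := 0) (y₀ := 0)
  rw [h0, h1, h2, h3, hQ' w hw, p3, p0, p1, p2]
  refine ⟨?_, ?_, ?_, ?_⟩ <;> apply Complex.ext <;> simp

include hsh in
/-- **The modulus flip**: for uniformizing data of `Q w` and `Q' w`, `η(Q' w) = 1 - η(Q w)`
(the marked points of `Q w` are those of `Q' w` shifted cyclically by three, same carrier).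
[cite: Ahlfors1979, Ch. 3 §3.1 and Ch. 6 §1.1] -/
theorem flip (w : ℝ)
    (φ : ConformalEquiv upperHalfPlaneSet (sh (Q' w)).carrier) (x : Fin 4 → ℝ)
    (φ' : ConformalEquiv upperHalfPlaneSet (Q' w).carrier) (x' : Fin 4 → ℝ)
    (hφ : (sh (Q' w)).IsUniformizing φ x) (hφ' : (Q' w).IsUniformizing φ' x') :
    crossRatio x' = 1 - crossRatio x := by
  obtain ⟨hc, -, -, -, h0, h1, h2, h3⟩ := hsh (Q' w)
  have hp : ∀ i, (sh (Q' w)).pt i = (Q' w).pt (i + 3) := by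
    intro i
    fin_cases i
    · exact h0
    · exact h1
    · exact h2
    · exact h3
  obtain ⟨φ'', x'', hφ'', hcr⟩ :=
    exists_isUniformizing_of_pt_eq_add_three (sh (Q' w)) hc (Q' w).pt hp φ' hφ'.1 hφ'.2
  have e := ConformalRectangle.crossRatio_eq_of_isUniformizing_holds hφ hφ''
  linarith

include hsh hQ' in
/-- **Every `η ∈ (0,1)` is the modulus of some `Q w`**: with `s = √η`, `k = (1-s)/(1+s) ∈ (0,1)`
and `w = 2K(k²)/K(1-k²)`, the box `(0,w) × (0,1)` marked `i, 0, w, w + i` has cross-ratio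
`(1-k)²/(1+k)² = η` (`rectangle_crossRatio_eq_elliptic_holds`).
[cite: BollobasRiordan2006, Ch. 7 §7.1 p. 185] -/
theorem surj (η : ℝ) (hη : η ∈ Ioo (0 : ℝ) 1) : ∃ w : ℝ, 0 < w ∧
    ∀ (φ : ConformalEquiv upperHalfPlaneSet (sh (Q' w)).carrier) (x : Fin 4 → ℝ),
      (sh (Q' w)).IsUniformizing φ x → crossRatio x = η := by
  obtain ⟨hη0, hη1⟩ := hη
  set s : ℝ := Real.sqrt η with hs
  have hs0 : 0 < s := Real.sqrt_pos.2 hη0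
  have hs1 : s < 1 := by
    rw [hs, Real.sqrt_lt' one_pos, one_pow]
    exact hη1
  have hs2 : (1 : ℝ) + s ≠ 0 := by linarith
  set k : ℝ := (1 - s) / (1 + s) with hk
  have hk0 : 0 < k := div_pos (by linarith) (by linarith)
  have hk1 : k < 1 := (div_lt_one (by linarith)).2 (by linarith)
  have hmod : (1 - k) ^ 2 / (1 + k) ^ 2 = η := by
    have h1 : (1 - k) / (1 + k) = s := by
      rw [hk]
      field_simp
      ring
    rw [← div_pow, h1, hs, Real.sq_sqrt hη0.le]
  set w : ℝ := 2 * ellipticK (k ^ 2) / ellipticK (1 - k ^ 2) with hw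
  have hwpos : 0 < w :=
    div_pos (mul_pos two_pos (ellipticK_sq_pos hk0 hk1)) (ellipticK_one_sub_sq_pos hk0 hk1)
  refine ⟨w, hwpos, fun φ x hφ => ?_⟩
  obtain ⟨p0, p1, p2, p3⟩ := lr_pt sh hsh Q' hQ' w hwpos
  obtain ⟨hcar, -, -⟩ := lr_family sh hsh Q' hQ' w hwpos
  have key := rectangle_crossRatio_eq_elliptic_holds k hk0 hk1 (sh (Q' w)) w 1 hwpos one_pos
    (by rw [div_one]) hcar ⟨by rw [p0]; simp, p1, p2, by rw [p3]; simp⟩ φ x hφ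
  rw [key, hmod]

include hsh hQ' in
/-- The boundary loop of `Q w` is that of `rectQuad 0 w 0 1` re-based at the fourth quarter
mark. [folklore] -/
theorem lr_boundary (w : ℝ) (hw : 0 < w) :
    (sh (Q' w)).boundary = (rectQuad 0 w 0 1 hw one_pos).boundary ∘ fun u => u + quarterMarks 3 := by
  funext u
  rw [(hsh (Q' w)).2.1 u, hQ' w hw]
  rfl

include hsh hQ' in
/-- The boundary loops of `Q (w n)` converge uniformly to that of `Q w₀` when `w n → w₀`.
[folklore] -/
theorem lr_tendstoUniformly (w : ℕ → ℝ) (w₀ : ℝ) (hwn : ∀ n, 0 < w n) (hw₀ : 0 < w₀)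
    (hlim : Tendsto w atTop (𝓝 w₀)) :
    TendstoUniformly (fun n => (sh (Q' (w n))).boundary) (sh (Q' w₀)).boundary atTop := by
  have e : (fun n => (sh (Q' (w n))).boundary) =
      fun n => (rectQuad 0 (w n) 0 1 (hwn n) one_pos).boundary ∘ fun u => u + quarterMarks 3 :=
    funext fun n => lr_boundary sh hsh Q' hQ' (w n) (hwn n)
  rw [e, lr_boundary sh hsh Q' hQ' w₀ hw₀]
  exact (tendstoUniformly_boundary_rectQuad hwn hw₀ hlim).comp fun u => u + quarterMarks 3

include hsh hQ' in
/-- The marked points of `Q (w n)` converge to those of `Q w₀` when `w n → w₀`. [folklore] -/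
theorem lr_tendsto_pt (w : ℕ → ℝ) (w₀ : ℝ) (hwn : ∀ n, 0 < w n) (hw₀ : 0 < w₀)
    (hlim : Tendsto w atTop (𝓝 w₀)) (i : Fin 4) :
    Tendsto (fun n => (sh (Q' (w n))).pt i) atTop (𝓝 ((sh (Q' w₀)).pt i)) := by
  obtain ⟨q0, q1, q2, q3⟩ := lr_pt sh hsh Q' hQ' w₀ hw₀
  have hofReal : Tendsto (fun n => ((w n : ℝ) : ℂ)) atTop (𝓝 ((w₀ : ℝ) : ℂ)) :=
    (Complex.continuous_ofReal.tendsto w₀).comp hlim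
  fin_cases i
  · show Tendsto (fun n => (sh (Q' (w n))).pt 0) atTop (𝓝 ((sh (Q' w₀)).pt 0))
    rw [q0]
    exact tendsto_const_nhds.congr fun n => ((lr_pt sh hsh Q' hQ' (w n) (hwn n)).1).symm
  · show Tendsto (fun n => (sh (Q' (w n))).pt 1) atTop (𝓝 ((sh (Q' w₀)).pt 1))
    rw [q1]
    exact tendsto_const_nhds.congr fun n => ((lr_pt sh hsh Q' hQ' (w n) (hwn n)).2.1).symm
  · show Tendsto (fun n => (sh (Q' (w n))).pt 2) atTop (𝓝 ((sh (Q' w₀)).pt 2))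
    rw [q2]
    exact hofReal.congr fun n => ((lr_pt sh hsh Q' hQ' (w n) (hwn n)).2.2.1).symm
  · show Tendsto (fun n => (sh (Q' (w n))).pt 3) atTop (𝓝 ((sh (Q' w₀)).pt 3))
    rw [q3]
    exact (hofReal.add tendsto_const_nhds).congr
      fun n => ((lr_pt sh hsh Q' hQ' (w n) (hwn n)).2.2.2).symm

end Families

end RectangleFamily

/-- **stub_rectangleFamily (R).** There are two families of conformal rectangles `Q w`, `Q' w`
(`w > 0`), both with carrier the open box `(0,w) × (0,1)`: `Q w` with arc `0` the left side
`{re = 0, im ∈ [0,1]}` and arc `2` the right side `{re = w, im ∈ [0,1]}`, `Q' w` with arc `0` the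
bottom side `{im = 0, re ∈ [0,w]}` and arc `2` the top side `{im = 1, re ∈ [0,w]}`; both
rectilinear; the modulus of `Q' w` is `1 -` the modulus of `Q w`; every `η ∈ (0,1)` is the modulus
of some `Q w`; and the modulus of `Q w` is continuous in `w`. Construction: `Q' w := rectQuad 0 w 0 1`
(corners marked counterclockwise from `0`), `Q w` its cyclic re-marking by three
(`RectangleFamily.exists_shift3`, corners `i, 0, w, w + i` — the marking of
`rectangle_crossRatio_eq_elliptic`); flip by the Möbius bookkeeping
`BoxCrossRatio.exists_isUniformizing_of_pt_eq_add_three` and conformal invariance of the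
cross-ratio; all moduli by `rectangle_crossRatio_eq_elliptic_holds` with `k = (1 - √η)/(1 + √η)`,
`w = 2K(k²)/K(1-k²)`; continuity by Radó (`ConformalRectangle.tendsto_crossRatio_of_tendstoUniformly`,
the boundary loops of `Q w` depend affinely on `w`).
[cite: BollobasRiordan2006, Ch. 7 §7.1 p. 185] [cite: PommerenkeBBCM1992, Thm. 2.11] -/
theorem stub_rectangleFamily :
    ∃ Q Q' : ℝ → ConformalRectangle,
      (∀ w : ℝ, 0 < w → (Q w).carrier = (Ioo (0 : ℝ) w ×ℂ Ioo (0 : ℝ) 1) ∧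
        (Q w).arc 0 = {z : ℂ | z.re = 0 ∧ z.im ∈ Icc (0 : ℝ) 1} ∧
        (Q w).arc 2 = {z : ℂ | z.re = w ∧ z.im ∈ Icc (0 : ℝ) 1}) ∧
      (∀ w : ℝ, 0 < w → (Q' w).carrier = (Ioo (0 : ℝ) w ×ℂ Ioo (0 : ℝ) 1) ∧
        (Q' w).arc 0 = {z : ℂ | z.im = 0 ∧ z.re ∈ Icc (0 : ℝ) w} ∧
        (Q' w).arc 2 = {z : ℂ | z.im = 1 ∧ z.re ∈ Icc (0 : ℝ) w}) ∧
      (∀ w : ℝ, 0 < w →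
        (∃ S : Finset (ℂ × ℂ), (∀ p ∈ S, p.1.re = p.2.re ∨ p.1.im = p.2.im) ∧
          frontier (Q w).carrier ⊆ ⋃ p ∈ S, segment ℝ p.1 p.2) ∧
        (∃ S : Finset (ℂ × ℂ), (∀ p ∈ S, p.1.re = p.2.re ∨ p.1.im = p.2.im) ∧
          frontier (Q' w).carrier ⊆ ⋃ p ∈ S, segment ℝ p.1 p.2)) ∧
      (∀ w : ℝ, 0 < w →
        ∀ (φ : ConformalEquiv UpperHalfPlane.upperHalfPlaneSet (Q w).carrier) (x : Fin 4 → ℝ)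
          (φ' : ConformalEquiv UpperHalfPlane.upperHalfPlaneSet (Q' w).carrier) (x' : Fin 4 → ℝ),
          (Q w).IsUniformizing φ x → (Q' w).IsUniformizing φ' x' →
            crossRatio x' = 1 - crossRatio x) ∧
      (∀ η ∈ Ioo (0 : ℝ) 1, ∃ w : ℝ, 0 < w ∧
        ∀ (φ : ConformalEquiv UpperHalfPlane.upperHalfPlaneSet (Q w).carrier) (x : Fin 4 → ℝ),
          (Q w).IsUniformizing φ x → crossRatio x = η) ∧
      (∀ w₀ : ℝ, 0 < w₀ → ∀ ε : ℝ, 0 < ε → ∃ ρ : ℝ, 0 < ρ ∧ ∀ w : ℝ, 0 < w → |w - w₀| < ρ →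
        ∀ (φ : ConformalEquiv UpperHalfPlane.upperHalfPlaneSet (Q w).carrier) (x : Fin 4 → ℝ)
          (φ₀ : ConformalEquiv UpperHalfPlane.upperHalfPlaneSet (Q w₀).carrier) (x₀ : Fin 4 → ℝ),
          (Q w).IsUniformizing φ x → (Q w₀).IsUniformizing φ₀ x₀ →
            |crossRatio x - crossRatio x₀| < ε) := by
  choose sh hsh using RectangleFamily.exists_shift3
  obtain ⟨Q', hQ'⟩ : ∃ Q' : ℝ → ConformalRectangle,
      ∀ (w : ℝ) (hw : 0 < w), Q' w = rectQuad 0 w 0 1 hw one_pos :=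
    ⟨fun w => if h : 0 < w then rectQuad 0 w 0 1 h one_pos else rectQuad 0 1 0 1 one_pos one_pos,
      fun w hw => dif_pos hw⟩
  refine ⟨fun w => sh (Q' w), Q', RectangleFamily.lr_family sh hsh Q' hQ',
    RectangleFamily.bt_family Q' hQ', fun w hw => ⟨?_, ?_⟩,
    fun w _ φ x φ' x' hφ hφ' => RectangleFamily.flip sh hsh Q' w φ x φ' x' hφ hφ',
    RectangleFamily.surj sh hsh Q' hQ', ?_⟩
  · exact isRectilinear_of_carrier_eq hw one_pos (RectangleFamily.lr_family sh hsh Q' hQ' w hw).1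
  · exact isRectilinear_of_carrier_eq hw one_pos (RectangleFamily.bt_family Q' hQ' w hw).1
  · exact RectangleFamily.modulus_continuous (fun w => sh (Q' w))
      (RectangleFamily.lr_tendstoUniformly sh hsh Q' hQ') (RectangleFamily.lr_tendsto_pt sh hsh Q' hQ')

end Summit.CriticalPhenomena.CardyFormulaZ2.Cruxes.SimilarityUpgrade.Stubs

end
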